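import Summits.BirchSwinnertonDyer.BirchSwinnertonDyer.Theorems.ErratumRoadFiveEulerHalfNotRamNoInertSetOfSAV
import HarnessLib

/-!
# Route `ErratumRoadFive` (K2, `p ≥ 5`), crux `EulerHalfNotRamNoInertSetAtFive` (item stmt-BirchSwinnertonDyer-19715), line `birth` v16 → v17:
# THE X11a INPUT RE-KEYED ON ITS `p ≥ 5` RESTRICTION — crux 19715 consumes `X11aLowerHalf` (item 19064) ONLY at primes `p ≥ 5`,
# so the `p = 3` residual of 19064 is NOT in the cone of 19715
# (cell `bsd-stepL`, LEAD `bsd-line-er5-p1` g4; `--supports stmt-BirchSwinnertonDyer-19715 --as helper`)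

WHAT. Every closer of the line (`EulerHalfBirthAssembly.eulerHalfNotRamNoInertSetAtFive_of_items_of_twoPrintFacts_of_SAV`, hence road A
`Theorems.eulerHalfNotRamNoInertSetAtFive_of_sevenItems` p651418 and road B `EulerHalfGalTrivialRoad.…_of_items7` p650861) binds the route item
`X11aLowerHalf` (`∀ Wd p, ClassX11a Wd p → Typed.MissingLowerBoundAt Wd p`, ALL odd `p`) but APPLIES it only at the pair's own prime `p ≥ 5`
(the twist of `E` by the Heegner field is an X11a pair AT THE SAME `p`: S1b `JetchevMaxHLAtP.missingUpperBoundAt_…_of_lowerX11a` on the Hoffstein–Luo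
odd frame; the `p`-anchor `EulerHalfPAnchor.eulerHalfNotRam_otherMult_of_pAnchor` on the Friedberg–Hoffstein inert frames). This file re-threads the
three places where the item is specialised to `p`, with the binder replaced by its `p ≥ 5` RESTRICTION
`∀ Wd p, ClassX11a Wd p → 5 ≤ p → Typed.MissingLowerBoundAt Wd p` (spelled out as a binder TYPE; no definition is introduced):
* §1 `JetchevMaxHLAtP.res_pOnlyMultCarrierAtFive_of_jetchevMaxHL_of_lowerX11aFive` ∕ `…_of_swapPrintFacts_of_lowerX11aFive` ∕
  `EulerHalfBirthAssembly.res_pOnlyMultCarrierAtFive_of_items_of_twoPrintFacts_of_lowerX11aFive` — S1b (bodies VERBATIM from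
  `…JetchevMaxHLAtPConsumer` §4, `…JetchevMaxHLAtPSwapStub`, `…NoInertSetOfBirth`; only the last argument changes);
* §2 `EulerHalfPAnchor.eulerHalfNotRam_otherMult_of_pAnchor_of_lowerX11aFive` — the `p`-anchor assembly (body VERBATIM from `…PAnchorResidual` §6d);
* §3 `EulerHalfBirthAssembly.eulerHalfNotRamNoInertSetAtFive_of_items_of_twoPrintFacts_of_SAV_of_lowerX11aFive` — the branching composition;
* the closers (the crux BY NAME from the SIX route items {19066, 19524, 19716, 20191, 20442, 27981} + the `p ≥ 5` restriction, both roads; and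
  modulo the x11a cell's PRINTED facts + ONE μ-certificate statement via `NonSurjChain.x11aLowerHalf_five_of_forall_muAnZeroAt_of_facts`) are the
  companion file `Theorems/ErratumRoadFiveEulerHalfNotRamNoInertSetAtFiveOfSixItemsLowerX11aFive.lean` (kept apart to stay under the size cap and
  to keep this file free of the leaf ∕ x11a imports).

WHY (LEAD g4, 2026-08-28). After v16 the open mathematics of 19715 is «published inputs + crux 19064». 19064 = unit pairs (free) + `p = 3` deep pairs +
`p ≥ 5` deep pairs (μ-certificate), per the 19064 line's own composition (`PrintX11aLowerHalfOfChildrenMuFive`, `PrintX11aLowerHalfFromFiveOfMuAn`, whose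
docstring READING already notes «route ErratumRoadFive consumes `X11aLowerHalf` only at `p ≥ 5`, so its binder h₃ could be re-typed to the `p ≥ 5`
restriction»). This file is the ER5-side glue for that re-typing. Whether 19715's `_of` binder is re-typed (a `p ≥ 5` child ∕ alias of 19064 filed
as an item) is the planners' call (ER5 ∕ PrintX11a); until then these are helpers and the skeleton's `_of` keeps `X11aLowerHalf` by name.

HONEST FRAMING: THEOREMS ONLY — no definition, no named fact, no `sorry`; every theorem is CONDITIONAL on its displayed binders (route items by name =
published inputs typed as named facts; the `p ≥ 5` X11a restriction, OPEN — it contains Greenberg's `μ`-conjecture on the deep X11a locus at `p ≥ 5`). Nothing is booked; item 19715 is NOT closed (exact-match close only); no census number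
moves (404 = 69 + 334 + 1 + 0); BSD is proved for no curve; no summit statement is touched.
-- adapted from Summits/BirchSwinnertonDyer/BirchSwinnertonDyer/Theorems/ErratumRoadFiveEulerHalfJetchevMaxHLAtPConsumer.lean §4,
-- …JetchevMaxHLAtPSwapStub.lean, …EulerHalfNotRamNoInertSetOfBirth.lean §1, …EulerHalfNotRamPAnchorResidual.lean §6d, …NoInertSetOfSAV.lean §1 (bodies verbatim,
-- the X11a binder restricted to `p ≥ 5`).
[cite: Jetchev2008, Thm. 1.1, Thm. 1.4, Cor. 1.5 (p. 812)] [cite: McCallumLMS1991, §5 Cor. 5.6 (p. 310)] [cite: PastenShimura2024, Prop. 6.13, Lemma 6.15, Lemma 6.18, §6.6]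
[cite: GrossLMS1991, Prop. 3.7 (2) (p. 240), §6 proof of Prop. 6.2 (1) (p. 245)] [cite: SilvermanATAEC1994, Cor. IV.9.2 (d), Table 4.1] [cite: Miller2011LMS, §1, Def. 1.1]
-/

set_option autoImplicit false
set_option linter.dupNamespace false -- `Summit.BirchSwinnertonDyer.BirchSwinnertonDyer` (summit = problem), tree-wide

noncomputable section

open scoped Classical

/-! ### §1 S1b (`p` the ONLY multiplicative prime) with the X11a lower half asked only at `p ≥ 5` -/

namespace Summit.BirchSwinnertonDyer.BirchSwinnertonDyer.Theorems.JetchevMaxHLAtP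

open WeierstrassCurve NumberField IsDedekindDomain Rat.HeightOneSpectrum
  Literature.NumberTheory.EllipticCurves
  Literature.NumberTheory.EllipticCurves.ModularForms
  Literature.NumberTheory.EllipticCurves.Rank1Residual
  Literature.NumberTheory.EllipticCurves.Rank1Residual.Typed
  Summit.BirchSwinnertonDyer.Rank1Residual Summit.BirchSwinnertonDyer.Rank1Residual.X11b
  Summit.BirchSwinnertonDyer.Rank1Residual.X11b.Three.Koly

/-- Place ↔ prime bridge for SPLIT multiplicative reduction (the tree's `hasSplitMultiplicativeReductionAtPrime_iff_hasSplitMultiplicativeReductionAt`,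
with the prime as a variable; copy of the private bridge of `…JetchevMaxHLAtPConsumer` §4). [folklore] -/
private theorem hasSplitMultiplicativeReductionAt_of_atPrime_five (W : WeierstrassCurve ℚ) [W.IsElliptic]
    (v : HeightOneSpectrum (𝓞 ℚ)) (p : ℕ) [Fact p.Prime] (hv : (primesEquiv v : ℕ) = p)
    (h : W.HasSplitMultiplicativeReductionAtPrime p) : W.HasSplitMultiplicativeReductionAt v := by
  subst hv
  exact (hasSplitMultiplicativeReductionAtPrime_iff_hasSplitMultiplicativeReductionAt W v).mp h

/-- **S1b of crux 19715 (registered text of `stub_res_pOnlyMultCarrierAtFive`, binders VERBATIM as conclusion) from `JetchevMaxHL`(p) and the X11a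
lower half AT `p ≥ 5` ONLY** (+ the published facts of `…JetchevMaxHLAtPConsumer` §3) — the tree's `res_pOnlyMultCarrierAtFive_of_jetchevMaxHL_of_lowerX11a`
with its last binder `hX11a : ∀ Wd p, ClassX11a Wd p → MissingLowerBoundAt Wd p` RESTRICTED to `5 ≤ p`: the consumer §3 applies the lower half at the
pair's own `p`, which is `≥ 5` here. Body verbatim (the place of `p` is the unique split multiplicative place, so it carries all of `ord_p ∏c`:
`CornerLocal.padicValNat_tamagawaNumberAt_eq_of_unique_split`). CONDITIONAL (as §3 there: `hJmax` = Jetchev at `p ∥ N`, `hMcU` McCallum, the restricted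
X11a lower half OPEN); nothing booked; 19715 NOT closed. [cite: Jetchev2008, Thm. 1.4 (p. 812)] [cite: SilvermanATAEC1994, Cor. IV.9.2 (d)] [cite: Miller2011LMS, Def. 1.1] -/
theorem res_pOnlyMultCarrierAtFive_of_jetchevMaxHL_of_lowerX11aFive
    (hGZ : ∀ (N : ℕ) [NeZero N] (W : WeierstrassCurve ℚ) (K : Type) [Field K] [NumberField K],
      gross_zagier N W K)
    (hKo : ∀ (N : ℕ) [NeZero N] (W : WeierstrassCurve ℚ) (K : Type) [Field K] [NumberField K],
      kolyvagin N W K)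
    (hGZK : rank_eq_analyticRank_of_analyticRank_le_one) (hmod : hasEntireLFunction_rat)
    (hnf : exists_isNewformOf) (hHL : HoffsteinLuo1997_exists_twist_L_one_ne_zero)
    (hMaz : mazur_not_dvd_maninConstant_of_odd)
    (hrec : ∀ (N : ℕ) [NeZero N] (W : WeierstrassCurve ℚ) (K : Type) [Field K] [NumberField K],
      heegnerPointOfConductor_one_galoisConj N W K)
    (hD36 : ∀ (N : ℕ) [NeZero N] (W : WeierstrassCurve ℚ) (K : Type) [Field K] [NumberField K],
      phi_heegnerTau_mem_singularModuliField N W K)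
    (hMcU : McCallum1991_padicValNat_card_sha_primary_add_le_of_globalDivisibility)
    (hJmax : ∀ (W : WeierstrassCurve ℚ) [W.IsElliptic] [W.IsGloballyMinimal] (p : ℕ) [Fact p.Prime]
      [NeZero (W.conductorNorm ℤ)] (K : Type) [Field K] [NumberField K]
      (Dt : ModularParametrizationData W (W.conductorNorm ℤ)) (β : ℤ) (ι : K →+* ℂ),
      5 ≤ p → W.analyticRank = 1 → W.HasMultiplicativeReductionAtPrime p → Surj W p →
      IsImaginaryQuadratic K → SatisfiesHeegnerHypothesis (W.conductorNorm ℤ) K →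
      Odd (NumberField.discr K) → NumberField.discr K < -4 →
      (W.quadraticTwist (NumberField.discr K : ℚ)).entireLFunction 1 ≠ 0 →
      (4 * (W.conductorNorm ℤ : ℤ)) ∣ β ^ 2 - NumberField.discr K → ¬ (p : ℤ) ∣ Dt.c →
      ∀ (v : HeightOneSpectrum (𝓞 ℚ)) (s : ℕ), s ≤ padicValNat p (W.tamagawaNumberAt v) →
        ∀ (n : ℕ) (d : KolyvaginHeegnerData Dt β ι n), Squarefree n →
          (∀ ℓ ∈ n.primeFactors, Zhang2014.IsKolyvaginPrime (W.conductorNorm ℤ) W K p ℓ ∧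
            s ≤ Zhang2014.kolyvaginIndex W p ℓ) → PDiv d p s)
    (hX11a : ∀ (Wd : WeierstrassCurve ℚ) [Wd.IsElliptic] [Wd.IsGloballyMinimal] (p : ℕ) [Fact p.Prime],
      ClassX11a Wd p → 5 ≤ p → Typed.MissingLowerBoundAt Wd p) :
    ∀ (W : WeierstrassCurve ℚ) [W.IsElliptic] [W.IsGloballyMinimal] (p : ℕ) [Fact p.Prime],
      Summit.BirchSwinnertonDyer.Rank1Residual.ClassX11b W p → 5 ≤ p →
      Literature.NumberTheory.EllipticCurves.Rank1Residual.Surj W p →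
      ¬ Literature.NumberTheory.EllipticCurves.Rank1Residual.Ram W p → p ∣ W.tamagawaProduct →
      (∀ (ℓ : ℕ) [Fact ℓ.Prime], W.HasMultiplicativeReductionAtPrime ℓ → ℓ = p) →
      W.HasSplitMultiplicativeReductionAtPrime p → p ∣ padicValInt p W.minimalDiscriminantInt →
      Literature.NumberTheory.EllipticCurves.Rank1Residual.Typed.MissingUpperBoundAt W p := by
  intro W _ _ p _ hX hp5 hρ hnram _ honly hsplit _
  have hp : p.Prime := Fact.out
  have hp2 : p ≠ 2 := by omega
  -- the place of p is the UNIQUE split multiplicative place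
  set v₀ : HeightOneSpectrum (𝓞 ℚ) := (primesEquiv (R := 𝓞 ℚ)).symm ⟨p, hp⟩ with hv₀_def
  have hv₀ : (primesEquiv v₀ : ℕ) = p := by rw [hv₀_def, Equiv.apply_symm_apply]
  have hs₀ : W.HasSplitMultiplicativeReductionAt v₀ :=
    hasSplitMultiplicativeReductionAt_of_atPrime_five W v₀ p hv₀ hsplit
  have huniq : ∀ v, W.HasSplitMultiplicativeReductionAt v → v = v₀ := by
    intro v hv
    haveI : Fact (primesEquiv v : ℕ).Prime := ⟨(primesEquiv v).2⟩
    have hmv : W.HasMultiplicativeReductionAtPrime (primesEquiv v : ℕ) :=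
      (hasMultiplicativeReductionAtPrime_primesEquiv_iff_holds W v (primesEquiv v : ℕ) rfl).mpr
        hv.hasMultiplicativeReductionAt
    have hq : (primesEquiv v : ℕ) = p := honly _ hmv
    apply (primesEquiv (R := 𝓞 ℚ)).injective
    rw [hv₀_def, Equiv.apply_symm_apply]
    exact Subtype.ext hq
  have hmono : ∃ v : HeightOneSpectrum (𝓞 ℚ),
      padicValNat p W.tamagawaProduct ≤ padicValNat p (W.tamagawaNumberAt v) :=
    ⟨v₀, (CornerLocal.padicValNat_tamagawaNumberAt_eq_of_unique_split W p hp5 hs₀ huniq).ge⟩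
  exact missingUpperBoundAt_of_classX11b_of_surj_of_not_ram_of_monoCarrier_of_jetchevMaxHL_of_lowerX11a hGZ hKo hGZK
    hmod hnf hHL hMaz hrec hD36 hMcU p hp2
    (fun V _ _ _ K _ _ Dt β ι ↦ hJmax V p K Dt β ι hp5) (fun Wd _ _ hXa ↦ hX11a Wd p hXa hp5) W hX hρ hnram hmono

/-- **S1b MODULO THREE PRINTED FACTS, the Cassels–Tate level inputs and the X11a lower half AT `p ≥ 5`** — the tree's
`res_pOnlyMultCarrierAtFive_of_swapPrintFacts_of_lowerX11a` with the X11a binder restricted to `5 ≤ p` (proof verbatim over §1's restricted consumer: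
-w2's swap end `jetchevMaxHLAtP_of_swapPrintFacts`, McCallum Cor. 5.6 upper via Cassels–Tate, the Literature THEOREMS
`heegnerPointOfConductor_one_galoisConj_holds` ∕ `phi_heegnerTau_mem_singularModuliField_holds`). CONDITIONAL (printed facts + the open restricted
lower half); no pair booked. [cite: Jetchev2008, Thm. 1.4, Cor. 1.5] [cite: McCallumLMS1991, Cor. 5.6] [cite: GrossLMS1991, §4 (4.1)] [cite: Miller2011LMS, Def. 1.1] -/
theorem res_pOnlyMultCarrierAtFive_of_swapPrintFacts_of_lowerX11aFive
    (hGZ : ∀ (N : ℕ) [NeZero N] (W : WeierstrassCurve ℚ) (K : Type) [Field K] [NumberField K], gross_zagier N W K)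
    (hKo : ∀ (N : ℕ) [NeZero N] (W : WeierstrassCurve ℚ) (K : Type) [Field K] [NumberField K], kolyvagin N W K)
    (hGZK : rank_eq_analyticRank_of_analyticRank_le_one) (hmod : hasEntireLFunction_rat)
    (hnf : exists_isNewformOf) (hHL : HoffsteinLuo1997_exists_twist_L_one_ne_zero)
    (hMaz : mazur_not_dvd_maninConstant_of_odd)
    (hCTi : ∀ (K : Type) [Field K] [NumberField K], casselsTate_levelInputs K)
    (hF : Literature.NumberTheory.EllipticCurves.GrossLMS1991.prop37_2_frobeniusCongruence ∧
      (∀ (K : Type) [Field K] [NumberField K] (n : ℕ) [NeZero n],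
        (Literature.NumberTheory.GaloisCohomology.LocalInvariants.canonical K n).SelmerComplement) ∧
      Literature.NumberTheory.EllipticCurves.Gross1991_heegnerPoint_sub_ratTorsion_mem_E0)
    (hX11a : ∀ (Wd : WeierstrassCurve ℚ) [Wd.IsElliptic] [Wd.IsGloballyMinimal] (p : ℕ) [Fact p.Prime],
      ClassX11a Wd p → 5 ≤ p → Typed.MissingLowerBoundAt Wd p) :
    ∀ (W : WeierstrassCurve ℚ) [W.IsElliptic] [W.IsGloballyMinimal] (p : ℕ) [Fact p.Prime],
      Summit.BirchSwinnertonDyer.Rank1Residual.ClassX11b W p → 5 ≤ p →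
      Literature.NumberTheory.EllipticCurves.Rank1Residual.Surj W p →
      ¬ Literature.NumberTheory.EllipticCurves.Rank1Residual.Ram W p → p ∣ W.tamagawaProduct →
      (∀ (ℓ : ℕ) [Fact ℓ.Prime], W.HasMultiplicativeReductionAtPrime ℓ → ℓ = p) →
      W.HasSplitMultiplicativeReductionAtPrime p → p ∣ padicValInt p W.minimalDiscriminantInt →
      Literature.NumberTheory.EllipticCurves.Rank1Residual.Typed.MissingUpperBoundAt W p :=
  res_pOnlyMultCarrierAtFive_of_jetchevMaxHL_of_lowerX11aFive hGZ hKo hGZK hmod hnf hHL hMaz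
    (fun N _ W K _ _ ↦ heegnerPointOfConductor_one_galoisConj_holds N W K)
    (fun N _ W K _ _ ↦ phi_heegnerTau_mem_singularModuliField_holds N W K)
    (McCallum1991_padicValNat_card_sha_primary_add_le_of_globalDivisibility_of_casselsTate_of_frobeniusCongruence_of_E0
      hCTi hF.1 hF.2.2)
    (jetchevMaxHLAtP_of_swapPrintFacts hF hGZ hmod) hX11a

end Summit.BirchSwinnertonDyer.BirchSwinnertonDyer.Theorems.JetchevMaxHLAtP

namespace Summit.BirchSwinnertonDyer.BirchSwinnertonDyer.Theorems.EulerHalfBirthAssembly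

open Summit.BirchSwinnertonDyer.BirchSwinnertonDyer.Theses.ErratumRoadFive
open Literature.NumberTheory.EllipticCurves Literature.NumberTheory.EllipticCurves.Rank1Residual
open Summit.BirchSwinnertonDyer.Rank1Residual

/-- **S1b BY NAME from the route items `PublishedInputsFive`, `ShimuraCasselsTateLevelInputs`, the TWO printed facts (Gross 1991 Prop. 3.7 (2)
image-free, Gross §6 ∕ [GZ86 III (3.1)] `E⁰`) and the X11a lower half AT `p ≥ 5`** — the tree's `res_pOnlyMultCarrierAtFive_of_items_of_twoPrintFacts`
with the item `X11aLowerHalf` replaced by its `p ≥ 5` restriction (proof verbatim; the `SelmerComplement` of THE canonical invariant maps is the kernel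
theorem `selmerComplement_canonical_holds`). CONDITIONAL on the displayed inputs; no pair is booked.
[cite: Jetchev2008, Thm. 1.4, Cor. 1.5] [cite: McCallumLMS1991, Cor. 5.6] [cite: GrossLMS1991, Prop. 3.7 (2), §6 Prop. 6.2 (1)] [cite: MilneADT2006, Ch. I Thm. 4.10(b)] -/
theorem res_pOnlyMultCarrierAtFive_of_items_of_twoPrintFacts_of_lowerX11aFive
    (h₅ : PublishedInputsFive) (hCTi : ShimuraCasselsTateLevelInputs)
    (hF₁ : GrossLMS1991.prop37_2_frobeniusCongruence)
    (hF₃ : Gross1991_heegnerPoint_sub_ratTorsion_mem_E0)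
    (h₃ : ∀ (Wd : WeierstrassCurve ℚ) [Wd.IsElliptic] [Wd.IsGloballyMinimal] (p : ℕ) [Fact p.Prime],
      ClassX11a Wd p → 5 ≤ p → Typed.MissingLowerBoundAt Wd p) :
    ∀ (W : WeierstrassCurve ℚ) [W.IsElliptic] [W.IsGloballyMinimal] (p : ℕ) [Fact p.Prime],
      ClassX11b W p → 5 ≤ p → Surj W p → ¬ Ram W p → p ∣ W.tamagawaProduct →
      (∀ (ℓ : ℕ) [Fact ℓ.Prime], W.HasMultiplicativeReductionAtPrime ℓ → ℓ = p) →
      W.HasSplitMultiplicativeReductionAtPrime p → p ∣ padicValInt p W.minimalDiscriminantInt →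
      Typed.MissingUpperBoundAt W p := by
  obtain ⟨hGZ, hKo, -, -, -, hGZK, hmod, hnf, hHL, -, hMaz, -, -, -, -⟩ := h₅
  exact JetchevMaxHLAtP.res_pOnlyMultCarrierAtFive_of_swapPrintFacts_of_lowerX11aFive hGZ hKo hGZK hmod hnf hHL hMaz hCTi
    ⟨hF₁, fun K _ _ n _ ↦ SchneiderFreeAdditiveX3.PoitouTateReduction.selmerComplement_canonical_holds K n, hF₃⟩ h₃

end Summit.BirchSwinnertonDyer.BirchSwinnertonDyer.Theorems.EulerHalfBirthAssembly

/-! ### §2 The `p`-anchor (a multiplicative prime `ℓ ≠ p` exists) with the X11a lower half asked only at `p ≥ 5` -/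

namespace Summit.BirchSwinnertonDyer.BirchSwinnertonDyer.Theorems.EulerHalfPAnchor

open WeierstrassCurve Literature.NumberTheory.EllipticCurves Literature.NumberTheory.EllipticCurves.BarriosEtAl2025
  Literature.NumberTheory.EllipticCurves.ModularForms Literature.NumberTheory.EllipticCurves.Rank1Residual
  Literature.NumberTheory.EllipticCurves.Rank1Residual.Typed Literature.NumberTheory.Automorphic
  Summit.BirchSwinnertonDyer.Rank1Residual Summit.BirchSwinnertonDyer.Rank1Residual.X11b

open NumberField IsDedekindDomain Rat.HeightOneSpectrum CongruenceSubgroup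
  Literature.NumberTheory.EllipticCurves.Wuthrich2014
  Literature.NumberTheory.EllipticCurves.BalakrishnanEtAl2019
  Literature.NumberTheory.QuadraticFields.Quadratic
  Summit.BirchSwinnertonDyer.BirchSwinnertonDyer.Theorems

/-- **S2 via the `p`-anchor with the X11a lower half AT `p ≥ 5`** — the tree's `eulerHalfNotRam_otherMult_of_pAnchor` (§6d of `…PAnchorResidual`) with
the item `X11aLowerHalf` replaced by its `p ≥ 5` restriction: the body specialises the lower half to the pair's own `p`, which is `≥ 5`; everything else
VERBATIM (`O` := the offending split carriers `≠ p`; `|O|` odd ⟹ road (A) on `S = {p} ∪ O`; `O = ∅` ⟹ road (A) on `S = {p, ℓ}`; `|O|` even `≥ 2` ⟹ the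
extra-place frame on `S = {p} ∪ (O ∖ {q₁})`, display SAVED at `q₁`). CONDITIONAL on the saved display `hSav`, the printed inert fact `hHKi` and the
binders; BSD is not proved; item 19715 is NOT closed by this file.
[cite: PastenShimura2024, Prop. 6.13, Lemma 6.15, Lemma 6.18, §6.6] [cite: Jetchev2008, Thm. 1.1, Cor. 1.5] [cite: RibetTakahashi1997, Thm. 1–2] -/
theorem eulerHalfNotRam_otherMult_of_pAnchor_of_lowerX11aFive
    (h₅ : Summit.BirchSwinnertonDyer.BirchSwinnertonDyer.Theses.ErratumRoadFive.PublishedInputsFive)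
    (h₃ : ∀ (Wd : WeierstrassCurve ℚ) [Wd.IsElliptic] [Wd.IsGloballyMinimal] (p : ℕ) [Fact p.Prime],
      ClassX11a Wd p → 5 ≤ p → Typed.MissingLowerBoundAt Wd p)
    (hJL : Summit.BirchSwinnertonDyer.BirchSwinnertonDyer.Theses.ErratumRoadFive.ShimuraParametrizationDataNonempty)
    (hCO : Summit.BirchSwinnertonDyer.BirchSwinnertonDyer.Theses.ErratumRoadFive.PastenComponentOrdersInput)
    (hHKi : shimuraCurve_heegnerPoint_grossZagier_kolyvagin_inert)
    (hSav : ∀ (W : WeierstrassCurve ℚ) [W.IsElliptic] [W.IsGloballyMinimal] (p : ℕ) [Fact p.Prime]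
      (q₁ : ℕ) [Fact q₁.Prime], ClassX11b W p → 5 ≤ p → Surj W p → ¬ Ram W p →
      W.HasSplitMultiplicativeReductionAtPrime q₁ → p ∣ padicValInt q₁ W.minimalDiscriminantInt →
      Theorems.ShimuraInertSavedDisplayAtD W p q₁)
    (W : WeierstrassCurve ℚ) [W.IsElliptic] [W.IsGloballyMinimal] (p : ℕ) [Fact p.Prime]
    (hX : ClassX11b W p) (hp5 : 5 ≤ p) (hsurj : Surj W p) (hnram : ¬ Ram W p)
    (hother : ∃ (ℓ : ℕ) (_ : Fact ℓ.Prime), ℓ ≠ p ∧ W.HasMultiplicativeReductionAtPrime ℓ) :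
    Typed.MissingUpperBoundAt W p := by
  classical
  obtain ⟨-, -, -, -, -, hGZK, hmod, hnf, -, -, hMaz, -, hFH, -, -⟩ := h₅
  obtain ⟨hr, hp2, hmult, hirr⟩ := id hX
  have hX11a : ∀ (Wd : WeierstrassCurve ℚ) [Wd.IsElliptic] [Wd.IsGloballyMinimal],
      ClassX11a Wd p → Typed.MissingLowerBoundAt Wd p := fun Wd _ _ hXa ↦ h₃ Wd p hXa hp5
  have hN0 : W.conductorNorm ℤ ≠ 0 := (W.conductorNorm_pos_holds).ne'
  -- the offending split `p`-carriers other than `p`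
  set O : Finset ℕ := (W.conductorNorm ℤ).primeFactors.filter (fun q ↦ q ≠ p ∧
      ∃ h : q.Prime, @WeierstrassCurve.HasSplitMultiplicativeReductionAtPrime W q ⟨h⟩ ∧
        p ∣ padicValInt q W.minimalDiscriminantInt) with hOdef
  have hOmult : ∀ q ∈ O, ∃ _ : Fact q.Prime, Mult W q := by
    intro q hq
    obtain ⟨-, -, hqprime, hsplit, -⟩ := Finset.mem_filter.mp hq
    haveI hqF : Fact q.Prime := ⟨hqprime⟩
    exact ⟨hqF, hsplit.hasMultiplicativeReductionAtPrime⟩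
  have hpO : p ∉ O := fun h ↦ (Finset.mem_filter.mp h).2.1 rfl
  have hcapture : ∀ (ℓ : ℕ) [Fact ℓ.Prime], ℓ ≠ p → W.HasSplitMultiplicativeReductionAtPrime ℓ →
      p ∣ padicValInt ℓ W.minimalDiscriminantInt → ℓ ∈ O := by
    intro ℓ hℓ hne hs hc
    have hℓN : ℓ ∣ W.conductorNorm ℤ :=
      (W.dvd_conductorNorm_iff_not_hasGoodReductionAtPrime ℓ).mpr
        (WeierstrassCurve.HasMultiplicativeReduction.not_hasGoodReduction (R := ℤ_[ℓ])
          hs.hasMultiplicativeReductionAtPrime)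
    exact Finset.mem_filter.mpr ⟨Nat.mem_primeFactors.mpr ⟨hℓ.out, hℓN, hN0⟩, hne, hℓ.out, hs, hc⟩
  rcases Nat.even_or_odd O.card with hev | hodd
  swap
  · ------------------------------------------------------------ `|O|` odd: road (A)'s frame `S = {p} ∪ O`
    refine missingUpperBoundAt_of_classX11b_of_not_ram_of_inertSet_pAnchor hGZK hmod hnf hFH hMaz hJL hCO
      hHKi W p hX hp5 hsurj hnram hX11a (insert p O) ?_ ?_ (Finset.mem_insert_self p O) ?_
    · intro ℓ hℓ
      rcases Finset.mem_insert.mp hℓ with rfl | hℓO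
      · exact ⟨inferInstance, hmult⟩
      · exact hOmult ℓ hℓO
    · rw [Finset.card_insert_of_notMem hpO]; exact hodd.add_one
    · intro ℓ _ hℓS hs hc
      by_cases hne : ℓ = p
      · subst hne; exact (hℓS (Finset.mem_insert_self _ _)).elim
      · exact (hℓS (Finset.mem_insert_of_mem (hcapture ℓ hne hs hc))).elim
  by_cases hO0 : O = ∅
  · ------------------------------------------------------------ no offender `≠ p`: road (A)'s frame `S = {p, ℓ}`
    obtain ⟨ℓ, hℓF, hℓp, hℓm⟩ := hother
    refine missingUpperBoundAt_of_classX11b_of_not_ram_of_inertSet_pAnchor hGZK hmod hnf hFH hMaz hJL hCO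
      hHKi W p hX hp5 hsurj hnram hX11a (insert p {ℓ}) ?_ ?_ (Finset.mem_insert_self p _) ?_
    · intro q hq
      rcases Finset.mem_insert.mp hq with rfl | hq'
      · exact ⟨inferInstance, hmult⟩
      · rw [Finset.mem_singleton] at hq'
        subst hq'
        exact ⟨hℓF, hℓm⟩
    · rw [Finset.card_pair (Ne.symm hℓp)]; exact even_two
    · intro q _ hqS hs hc
      by_cases hne : q = p
      · subst hne; exact (hqS (Finset.mem_insert_self _ _)).elim
      · have hqO := hcapture q hne hs hc
        rw [hO0] at hqO
        exact (Finset.notMem_empty q hqO).elim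
  · ------------------------------------------------------------ `|O|` even `≥ 2`: exempt `q₁ ∈ O`, the extra-place frame
    obtain ⟨q₁, hq₁O⟩ := Finset.nonempty_iff_ne_empty.mpr hO0
    obtain ⟨-, hq₁p, hq₁prime, hsplit₁, hcar₁⟩ := Finset.mem_filter.mp hq₁O
    haveI hq₁F : Fact q₁.Prime := ⟨hq₁prime⟩
    have hbad₁ : ¬ W.HasGoodReductionAtPrime q₁ :=
      WeierstrassCurve.HasMultiplicativeReduction.not_hasGoodReduction (R := ℤ_[q₁])
        hsplit₁.hasMultiplicativeReductionAtPrime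
    have hshape : ∀ (q : ℕ) [Fact q.Prime], q ≠ q₁ → p ∣ (W.baseChange ℚ_[q]).localTamagawaNumber ℤ_[q] →
        W.HasSplitMultiplicativeReductionAtPrime q := by
      intro q _ _ hdvd
      haveI : (W.baseChange ℚ_[q]).IsElliptic := inferInstanceAs (W.map (algebraMap ℚ ℚ_[q])).IsElliptic
      exact hasSplitMultiplicativeReduction_of_five_le_of_dvd_localTamagawaNumber q (W.baseChange ℚ_[q]) hp5 hdvd
    have hSavD : Theorems.ShimuraInertSavedDisplayAtD W p q₁ := hSav W p q₁ hX hp5 hsurj hnram hsplit₁ hcar₁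
    have hTL := Theorems.fhTwinLowerSupplyAt_of_friedbergHoffstein_of_x11aLowerHalf hGZK hmod hnf hFH W p hX hnram hX11a
    have hpO' : p ∉ O.erase q₁ := fun h ↦ hpO (Finset.mem_of_mem_erase h)
    refine missingUpperBoundAt_of_classX11b_of_inertSet_of_extraPlace_odd_of_twinLowerD_pAnchor hGZK hmod hnf hMaz
      localTamagawaNumber_quadraticTwist_two_mem_of_goodReduction_holds hJL hCO W p hX hp5 hsurj q₁ hbad₁ hshape hSavD hTL
      (insert p (O.erase q₁)) ?_ ?_ (Finset.mem_insert_self p _) ?_ ?_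
    · intro ℓ hℓ
      rcases Finset.mem_insert.mp hℓ with rfl | hℓO
      · exact ⟨inferInstance, hmult⟩
      · exact hOmult ℓ (Finset.mem_of_mem_erase hℓO)
    · rw [Finset.card_insert_of_notMem hpO', Finset.card_erase_of_mem hq₁O,
        Nat.sub_add_cancel (Finset.card_pos.mpr ⟨q₁, hq₁O⟩)]
      exact hev
    · intro h
      rcases Finset.mem_insert.mp h with h | h
      · exact hq₁p h
      · exact Finset.notMem_erase q₁ O h
    · intro ℓ _ hℓS hne hs hc
      by_cases hℓp : ℓ = p
      · subst hℓp; exact (hℓS (Finset.mem_insert_self _ _)).elim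
      · exact (hℓS (Finset.mem_insert_of_mem (Finset.mem_erase.mpr ⟨hne, hcapture ℓ hℓp hs hc⟩))).elim

end Summit.BirchSwinnertonDyer.BirchSwinnertonDyer.Theorems.EulerHalfPAnchor

/-! ### §3 The branching composition (S1b ∣ `p`-anchor) with the X11a lower half asked only at `p ≥ 5` -/

namespace Summit.BirchSwinnertonDyer.BirchSwinnertonDyer.Theorems.EulerHalfBirthAssembly

open Summit.BirchSwinnertonDyer.BirchSwinnertonDyer.Theses.ErratumRoadFive
open Literature.NumberTheory.EllipticCurves Literature.NumberTheory.EllipticCurves.Rank1Residual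
open Summit.BirchSwinnertonDyer.Rank1Residual Summit.BirchSwinnertonDyer.BirchSwinnertonDyer

/-- **CRUX 19715 BY NAME FROM FIVE ROUTE ITEMS + THE `p ≥ 5` X11a LOWER HALF + THE TWO PRINTED FACTS + SAV.** The tree's
`eulerHalfNotRamNoInertSetAtFive_of_items_of_twoPrintFacts_of_SAV` with `X11aLowerHalf` replaced by its `p ≥ 5` restriction (proof verbatim over §1 ∕ §2:
`p` the only multiplicative prime ⟹ S1b; otherwise the `p`-anchor on `hSav` with the inert display from the items). CONDITIONAL; 19715 NOT closed by this helper.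
[cite: Jetchev2008, Thm. 1.4, Cor. 1.5] [cite: PastenShimura2024, Prop. 6.13, Lemma 6.18, §6.6] [cite: SilvermanATAEC1994, Cor. IV.9.2 (d)] -/
theorem eulerHalfNotRamNoInertSetAtFive_of_items_of_twoPrintFacts_of_SAV_of_lowerX11aFive
    (h₅ : PublishedInputsFive)
    (h₃ : ∀ (Wd : WeierstrassCurve ℚ) [Wd.IsElliptic] [Wd.IsGloballyMinimal] (p : ℕ) [Fact p.Prime],
      ClassX11a Wd p → 5 ≤ p → Typed.MissingLowerBoundAt Wd p)
    (hJL : ShimuraParametrizationDataNonempty)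
    (hCO : PastenComponentOrdersInput) (hCTi : ShimuraCasselsTateLevelInputs)
    (hESi : ShimuraHeegnerEulerSystemInertPrintedR)
    (hF₁ : GrossLMS1991.prop37_2_frobeniusCongruence)
    (hF₃ : Gross1991_heegnerPoint_sub_ratTorsion_mem_E0)
    (hSav : ∀ (W : WeierstrassCurve ℚ) [W.IsElliptic] [W.IsGloballyMinimal] (p : ℕ) [Fact p.Prime]
      (q₁ : ℕ) [Fact q₁.Prime], ClassX11b W p → 5 ≤ p → Surj W p → ¬ Ram W p →
      W.HasSplitMultiplicativeReductionAtPrime q₁ → p ∣ padicValInt q₁ W.minimalDiscriminantInt →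
      Theorems.ShimuraInertSavedDisplayAtD W p q₁) :
    EulerHalfNotRamNoInertSetAtFive := by
  intro W _ _ p _ hX hp5 hsurj hram htam _hno
  by_cases h : ∀ (ℓ : ℕ) [Fact ℓ.Prime], W.HasMultiplicativeReductionAtPrime ℓ → ℓ = p
  · -- `p` is the only multiplicative prime: the split carrier that `p ∣ ∏c` provides is multiplicative, hence it is `p`
    obtain ⟨ℓ, hℓ, hsplit, hdvd⟩ := (X11b.dvd_tamagawaProduct_iff_exists_split (W := W) (Fact.out : p.Prime) hp5).mp htam
    have hℓp : ℓ = p := h ℓ hsplit.hasMultiplicativeReductionAtPrime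
    subst hℓp
    exact res_pOnlyMultCarrierAtFive_of_items_of_twoPrintFacts_of_lowerX11aFive h₅ hCTi hF₁ hF₃ h₃ W _ hX hp5 hsurj hram htam h hsplit hdvd
  · have hother : ∃ (ℓ : ℕ) (_ : Fact ℓ.Prime), ℓ ≠ p ∧ W.HasMultiplicativeReductionAtPrime ℓ := by
      by_contra hc
      exact h fun ℓ _ hm ↦ by_contra fun hne ↦ hc ⟨ℓ, ‹_›, hne, hm⟩
    exact Theorems.EulerHalfPAnchor.eulerHalfNotRam_otherMult_of_pAnchor_of_lowerX11aFive h₅ h₃ hJL hCO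
      (Theorems.EulerHalfPAnchor.shimuraInertDisplayKolyvagin_of_items h₅ hCTi hESi) hSav W p hX hp5 hsurj hram hother

end Summit.BirchSwinnertonDyer.BirchSwinnertonDyer.Theorems.EulerHalfBirthAssembly

end
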